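import Mathlib
import HarnessLib
import HarnessLib.Audit
import Summits.FinalStateConjecture.Statement
import Literature.Geometry.Lorentzian.TameGenericityLocal
import Summits.FinalStateConjecture.FinalStateConjecture.Theorems.CurvatureOrSymmetryLocalExitSuffices

/-!
Route: TangentProfileCensorship

DORMANT since 2026-09-04T18:31:52Z (reconciler: no traction for 5 d (last activity statement-checked at 2026-08-30T17:34:38Z); parked, not closed — `ledger route dormant route-FinalStateConjecture-TangentProfileCensorship --off` to reac) — unstaffed, not closed; items shared with open routes are served there. `ledger route dormant <id> --off` reactivates.

# Route TangentProfileCensorship — censorship conjunct by blow-up at a first naked point — tangent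
profiles, smooth-class instability, two-sided exit into the Kerr basin; censored half imported

It suffices to show X = NakedDataTameExit ∧ CensoredDataTameExit (with the support statement
MGHDExistence).
The exceptional set of the RE-TYPED summit (T2, p126844, 2026-08-16), E = {admissible D : ¬(an MGHD
exists ∧ every MGHD has
complete 𝓘⁺ and SETTLES — a sub-extremal N-Kerr final-state decomposition d of its self-determined
exterior O = J⁺(ιX) ∩ I⁻(charts)
with every future-complete normalised null ray from the data staying in closure O
(`RaysStayInClosure`), honest exhaustive charts
(`HasExhaustiveCharts`: near-zone radii Rᵢ(τ) → ∞, Rᵢ(τ) ≥ max(r₊,0)+1) and future-oriented chart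
time (`IsFutureOriented`))},
is split by the censorship dichotomy, and genericity is TAME (`IsTameChristodoulouGeneric … 1`): the
witness curve lives on ONE
fixed asymptotically flat end e of X (every member Dafermos–Rodnianski flat on e with continuous
mass, wDist-continuous at c = 0)
and is immersed at c = 0. NAKED PART (card wcc-tangent-profiles-smooth-spectral-instability, the
spine): through every admissible
datum one of whose maximal developments has INCOMPLETE future null infinity pass an end e and a
tame, immersed, injective curve of
admissible data whose members at small parameter c ≠ 0 are good (NakedDataTameExit) — to be earned
by blow-up analysis at a first
naked point: scale-critical tangent profile, smooth-class spectral instability of the profile,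
two-sided nonlinear exit along a
compactly supported / glued constraint-satisfying perturbation on the SAME end (tame by
`isTameDataFamily_restrict_of_agree_off_compact`,
TameFamilyOffCompact.lean; immersed because the exit direction is a non-zero jet), finitely many
naked points, landing in the
Kerr basin. CENSORED PART (imported from the Kerr-basin cards): through every admissible censored
datum with an MGHD that does
not settle in the re-typed sense passes such a curve (CensoredDataTameExit). LOCAL exits (0 < ‖c‖ <
ε) are reparametrised to
global ones by the PROVED Literature lemma `InitialDataSet.isTameChristodoulouGeneric_of_local`
(TameGenericityLocal.lean:
radial contraction c ↦ ε(1+‖c‖²)^{-1/2}c preserves tameness, immersion, injectivity), which replaces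
the former support item
LocalExitSuffices; MGHDExistence (Choquet-Bruhat–Geroch over the repaired `VacuumCauchyDevelopment`)
feeds the censored case.
The conjunction tax of Christodoulou genericity (card genericity-is-not-closed-under-and) is paid by
making BOTH exits land in
the full good set, not in their own conjunct. Repair (rev 5, statement-revised): the pre-re-type
items NakedDataExit /
CensoredDataExit (smooth families, old good set) and LocalExitSuffices are dropped from this route;
the new conjuncts
(`RaysStayInClosure`, honest-radii `HasExhaustiveCharts`, `IsFutureOriented`) and the tame immersed
witness family are supplied
INSIDE the two crux conclusions (basin landing of the exit data), not as extra hypotheses.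
Lean: `MGHDExistence ∧ NakedDataTameExit ∧ CensoredDataTameExit`

## Assembly
Pure logic, sorry-free in Sketch.lean / glue.lean (`theorem closes`, axioms propext /
Classical.choice / Quot.sound): fix X;
by `isTameChristodoulouGeneric_of_local` a LOCAL tame good exit through every exceptional admissible
D suffices; case split on
"every MGHD of D has complete 𝓘⁺": if not, NakedDataTameExit gives the local exit; if so,
MGHDExistence gives an MGHD, and since
D is exceptional some MGHD fails to settle in the re-typed sense, so CensoredDataTameExit gives it.
Honest top (Sketch.lean, rc 0):
FinalStateConjecture → NakedDataTameExit, FinalStateConjecture → CensoredDataTameExit, and under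
MGHDExistence
(NakedDataTameExit ∧ CensoredDataTameExit) ↔ FinalStateConjecture — the two cruxes are exactly the
naked / censored halves of the
re-typed exceptional set.

Rationale: WHY THIS LINE. Mechanism (card): if an MGHD of smooth admissible data has incomplete sojourn-𝓘⁺,
localise a first naked ideal point p with regular
past cone, rescale at p, and extract a self-similar vacuum TANGENT PROFILE
(RodnianskiShlapentokhRothman2023 and arXiv:2205.11715 are
the known profiles; arXiv:1705.09674 the asymptotically self-similar regime); the
renormalisation-group picture of critical collapse
(arXiv:gr-qc/9503007, GundlachMartingarcia2007) says p is removable iff the profile has a relevant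
(unstable) mode, and the bet is
that every profile that can be tangent to a SMOOTH solution has one in the smooth class — engine
imported from supercritical blow-up
analysis: MRRS finite-codimension stability of smooth self-similar profiles (MerleEtAl2022,
arXiv:1912.11009), Donninger-type mode
stability/instability in similarity variables now available without symmetry (arXiv:1604.00303,
arXiv:2601.19515), interval-arithmetic
certification profile by profile (BuckmasterCaolaboraGomezserrano2025), and the two-sided nonlinear
exit by scale-critical
trapped-surface formation (An2025, arXiv:1409.6270, LiLiu2022). What is new since the card was
graded: Zheng arXiv:2605.16235 with
Singh–Zheng arXiv:2605.16095 (2026) prove Christodoulou's k-self-similar naked singularities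
LINEARLY AND NONLINEARLY STABLE at their
own threshold regularity C^{1,k²/(1−k²)} (k² ≪ 1) — so "every profile is unstable" is false
profile-class-blind, and the line must
use that the summit's data are C^∞: only profiles tangent to smooth solutions are claimed smoothly
unstable (the critical-collapse,
regular-horizon profiles), which is exactly the codimension-one Choptuik picture and exactly what no
prior work states for vacuum.
The typed layer is the honest top of ANY censorship-spined assembly of this summit: the
naked/censored case split with both exits
landing in the full good set (the only way two Christodoulou-generic clauses compose), so
CensoredDataTameExit is to be shared verbatim with
the Kerr-basin routes and NakedDataTameExit is where this card's blow-up analysis is spent.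
Statement re-type T2 (p126844, 2026-08-16): genericity is now TAME on one fixed end
(`IsTameChristodoulouGeneric`) and the
good set demands `RaysStayInClosure`, honest-radii `HasExhaustiveCharts` and `IsFutureOriented`;
both are absorbed by the
exits themselves — the blow-up exit direction is a compactly supported / glued perturbation on the
same end (tame by
TameFamilyOffCompact.lean, immersed as a non-zero jet), and basin landing is asked in the re-typed
sense — while the
local-to-global reparametrisation is the proved Literature lemma
`isTameChristodoulouGeneric_of_local` (TameGenericityLocal.lean).

RANKED CRUXES. #2 NakedDataTameExit (crux) — NAKED DATA TAME EXIT (card Steps 1–5 + basin landing,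
local form, re-typed T2): for every connected Hausdorff second-countable smooth 3-manifold X and
every admissible datum D on X having a maximal vacuum Cauchy development with INCOMPLETE future null
infinity (sojourn form), there are ONE asymptotically flat end e of X and a one-parameter family F
of admissible data, tame on e (jointly smooth; e the sole end; every member Dafermos–Rodnianski flat
on e with continuous mass M(c); wDist-continuous at c = 0), immersed at c = 0, injective, with F 0 =
D, and an ε > 0 such that for 0 < ‖c‖ < ε the datum F c is good in the re-typed sense: it has an
MGHD, and every MGHD has complete 𝓘⁺ and carries a sub-extremal N-Kerr final-state decomposition of
its self-determined exterior O whose closure keeps every future-complete normalised null ray from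
the data (RaysStayInClosure), with honest exhaustive charts (HasExhaustiveCharts) and
future-oriented chart time (IsFutureOriented). [difficulty: open-problem] (why it might fail: Zheng
arXiv:2605.16235 Thm 1.3: CSS naked singularities are STABLE at threshold regularity, so only
profiles tangent to SMOOTH data can be unstable; exit data must land in the FULL re-typed good set
(Kerr settling, honest radii, rays in closure, orientation; known only for |a|≪M,
arXiv:2104.11857).) [Christodoulou1999instability, RodnianskiShlapentokhRothman2023,
arXiv:2605.16235, arXiv:2605.16095, An2025, LiLiu2022, KlainermanSzeftel2023, arXiv:1912.11009,
arXiv:gr-qc/9503007, arXiv:2205.11715]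
#3 CensoredDataTameExit (crux) — CENSORED DATA TAME EXIT (the final-state half at censored data,
local form, re-typed T2; to be shared with the Kerr-basin routes): for every X as above and every
admissible datum D which has an MGHD, all of whose MGHDs have complete 𝓘⁺, but some MGHD of which
carries NO sub-extremal N-Kerr final-state decomposition of its self-determined exterior with
RaysStayInClosure, HasExhaustiveCharts (honest radii) and IsFutureOriented, there are an end e of X,
a tame (on e), immersed, injective one-parameter admissible family F through D and ε > 0 with F c
good (re-typed sense) for 0 < ‖c‖ < ε. [difficulty: open-problem] (why it might fail: Needs Kerr
stability for LARGE censored data (only |a|≪M known, arXiv:2104.11857), non-genericity of extremal /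
infinitely-many-hole end states (arXiv:2211.15742); RaysStayInClosure is interior-flavoured: a
future-complete null ray from Σ in the hole off closure(DOC) makes settled data exceptional.)
[DafermosLuk2017, KlainermanSzeftel2023, GiorgiKlainermanSzeftel2022,
DafermosHolzegelRodnianskiTaylor2021, KehleUnger2025, AngelopoulosKehleUnger2024, arXiv:0711.4612]
#9 MGHDExistence (support) — every admissible datum has a maximal globally hyperbolic vacuum
development, stated over the repaired structure `VacuumCauchyDevelopment` (the corrected form of the
deprecated `choquetBruhat_geroch_exists_mghd`, recorded in `CauchyProblemExistenceDefect`);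
Choquet-Bruhat–Geroch 1969 Thm. 3, Sbierski 2016 Thm. 2.6. Known theorem; large formalisation;
shared by every route of this summit. [difficulty: XL] [ChoquetBruhatGeroch1969CMP, Sbierski2016AHP,
Ringstrom2009]
#1 Assembly (assembly) — MGHDExistence → NakedDataTameExit → CensoredDataTameExit →
FinalStateConjecture (restated; it is literally `closes`).
Dropped at rev 5 (statement re-type T2): NakedDataExit, CensoredDataExit (smooth families into the
pre-re-type good set — corollaries of / incomparable with the tame items, no longer glue-relevant)
and LocalExitSuffices (proved, stmt-FinalStateConjecture-9938; superseded as glue by the proved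
Literature lemma `InitialDataSet.isTameChristodoulouGeneric_of_local`, still wanted by route
CurvatureOrSymmetry).

TWO-LAYER PLAN. Foreseen glued split of NakedDataTameExit once definitions land (filed now as
INFORMAL crux items ranks 4–6 + definition requests,
signatures later): NakedDataTameExit ⇐ TangentProfileExtraction → SmoothProfileInstability →
NakedPointQuantisation → NakedDataTameExit,
where TangentProfileExtraction = at a first naked ideal point p (regular past cone) of an MGHD of
smooth admissible data the
scale-critical rescalings converge subsequentially to a NONFLAT continuously or discretely
self-similar vacuum profile regular
inside its vertex past cone (monotonicity-formula / concentration-compactness bet);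
SmoothProfileInstability = every such profile
that is tangent to a SMOOTH solution has, modulo gauge and symmetries, ≥ 1 unstable smooth eigenmode
of the linearised vacuum
equations in self-similar time s = −log(T−t), certified profile by profile, and the two-sided
nonlinear exit along it makes p a
regular or trapped point of the perturbed MGHD (An–Luk scale-critical trapped surface on the
over-focusing side); NakedPointQuantisation
= a flux quantum per profile bounded by the data ⇒ finitely many first naked points, so one curve
exits all of them, and the exit
data land in the Kerr basin in the re-typed sense and the exit family is realised on the SAME end by
compactly supported / glued perturbations (tame, immersed; shared with CensoredDataTameExit's
programme). CensoredDataTameExit is not split here (other routes own it).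

KILL CRITERIA. Refutation of NakedDataTameExit (e.g. naked data accumulating two-sidedly along EVERY
tame immersed admissible curve through a
naked datum — which a vacuum analogue of Zheng's threshold stability for profiles tangent to smooth
solutions would produce) closes
the route `refuted:NakedDataTameExit` and refutes the censorship conjunct of the typed summit itself
(honest top: the Statement implies
both cruxes). Refutation of CensoredDataTameExit (stable extremal endpoint family, Cantor lamination
of censored thresholds, or a settled
MGHD violating RaysStayInClosure / IsFutureOriented for EVERY decomposition) falsifies the typed
summit; close. SmoothProfileInstability
refuted for a profile that IS tangent to smooth data (a smoothly mode-stable regular-horizon vacuum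
critical solution) ⇒ pivot
impossible, close `refuted`. SmoothProfileInstability refuted only for kinked profiles ⇒ no damage
(expected, Zheng). A proof of
NakedDataTameExit by another mechanism (Raychaudhuri blow-down, curvature-or-symmetry cards)
supersedes the layer-2 plan, not the route.

NOT DECOMPOSED YET. The causal-boundary structure theorem giving a FIRST naked ideal point with
regular past cone (TIP analysis); the scale-critical
monotone/almost-monotone quantity for Ric = 0 (none known — the biggest bet; substitute: An–Luk-norm
concentration compactness);
rigidity of continuously self-similar vacuum profiles regular inside the cone (RSR expect the 3+1
interior problem to be elliptic and
rigid, so CSS tangent profiles should be cone-kinked or trivial and the live case is DSS/echoing);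
the transport of the unstable
eigendirection to constraint-satisfying admissible data on X realised on the SAME end (conformal
method / Corvino–Schoen-type gluing,
compact support ⇒ tame by TameFamilyOffCompact.lean); basin landing of the exit data in the re-typed
sense incl. RaysStayInClosure and
IsFutureOriented of the final charts (shared with CensoredDataTameExit); all constants. These are
layer-2 children or `--supports` lemmas, not items now.

CHEAPEST FALSIFIER. Literature check, one afternoon: do the complete RSR–SR vacuum naked-singularity
data (arXiv:1912.08478 Thm 1 item 3 +
arXiv:2204.09891) sit at a THRESHOLD regularity C^{1,cε²} across the singular horizon exactly as
Christodoulou's k-data do, and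
does the Singh–Zheng linearised stability (arXiv:2605.16095, §1.3) transfer to perturbations
at/above threshold? If yes, the only
profiles the route may claim unstable are regular-horizon (critical-collapse) ones, and the route
stands or falls with "smooth
data have regular-horizon tangent profiles" — then check the vacuum critical-collapse numerics
(arXiv:2303.05530, arXiv:2606.27431):
a vacuum critical solution with MORE than one unstable mode, or none, kills
SmoothProfileInstability's codimension-one picture.

NUMBERS. Christodoulou k-self-similar naked singularities: 0 < k² < 1/3, data C^{1,k²/(1−k²)} at the
singular sphere (threshold regularity);
Zheng/Singh–Zheng stability: 0 < k² ≪ 1, perturbations in 𝒞^{1,k²/(1−k²)}_loc (arXiv:2605.16235 Thm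
1.3); RSR vacuum: g ∈ C^N ∩
C^{1,cε²} across v̂ = 0, 0 < ε ≪ γ ≪ 1, ‖χ̂‖_{L²} ∼ ε⁻¹ (arXiv:1912.08478 Thm 1, Rem 1.4); Harada:
naked self-similar perfect-fluid
attractor with NO unstable spherical mode for 0 < k ≲ 0.0105 (arXiv:gr-qc/9807038); Choptuik scalar
critical solution: one relevant
mode, echoing period Δ ≈ 3.44, exponent γ ≈ 0.374 (GundlachMartingarcia2007); vacuum critical
collapse: no clean universal DSS
seen (arXiv:2303.05530). Items after rev 5: 2 cruxes (NakedDataTameExit, CensoredDataTameExit), 1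
support (MGHDExistence), 1 assembly, 3 informal layer-2 cruxes.

DEFINITION REQUESTS. D1 `FirstNakedPoint` (Literature/Geometry/Lorentzian): terminal indecomposable
past set / causal-boundary ideal point p of an MGHD
with incomplete sojourn-𝓘⁺ whose past ∩ J⁺(ιX) is regular and which is earliest among such
(Geroch–Kronheimer–Penrose 1972;
RodnianskiShlapentokhRothman2023 Def 1.1). D2 `SelfSimilarVacuumProfile`
(Literature/Geometry/Lorentzian): Ricci-flat spacetime with
a proper homothetic vector field K, ℒ_K g = 2g (CSS), resp. a discrete homothety (DSS), with vertex,
regular vertex past cone, and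
the regularity class across the singular horizon as a parameter (RSR 2023 §1.2; arXiv:2205.11715;
Fefferman–Graham). D3
`IsTangentProfileAt` (Summits/FinalStateConjecture/FinalStateConjecture/Theorems): convergence of
scale-critical rescalings
λ⁻²Φ_λ^*g at p to a profile. D4 `HasSmoothUnstableMode` (same topic): the linearised vacuum operator
about a profile in
self-similar time has point spectrum with Re > 0 on smooth weighted spaces modulo gauge/symmetry
modes (MerleEtAl2022;
arXiv:2601.19515). Filed with `ledger workitem add --kind definition` after open, `--for` the
informal crux items.

Novelty: Searches (2026-08-15): `lit frontier FinalStateConjecture --since 2021` (30 rows; relevant: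
arXiv:2412.09540 DSS exterior-naked
singularities, arXiv:2601.04152 visibility obstructions, arXiv:2409.14582 trapped surfaces in
geodesic foliation); `lit bridges
FinalStateConjecture --cross any` (30 rows, surveys only); `lit search --source arxiv` × 10:
"instability naked singularities
gravitational collapse" (8; NEW: arXiv:2605.16235 Zheng 2026 nonlinear stability of CSS naked
singularities), "linearized stability
continuously self-similar naked singularities" (1: arXiv:2605.16095 Singh–Zheng), "mode stability
self-similar wave maps" (7:
arXiv:1604.00303, arXiv:2601.19515 without symmetry, 2026), "exterior-naked singularities
Einstein-scalar field" (8: arXiv:2412.09540,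
arXiv:2210.11325, arXiv:2508.07655), "renormalization group critical behaviour gravitational
collapse" (3: gr-qc/9503007,
gr-qc/9607010, arXiv:2207.04373), "critical collapse vacuum gravitational waves discrete
self-similarity" (5: arXiv:2303.05530,
arXiv:2606.27431), "asymptotically self-similar naked singularity smooth data Einstein" (2:
arXiv:2112.10826 Einstein–Euler naked
singularities), "self-similar implosion compressible Euler smooth profiles" (6), "naked
singularities Einstein vacuum equations
exterior solution" (4: arXiv:1912.08478, 2204.09891, 2205.11715); `lit galaxy search --star all`
"self-similar naked singularities"
(0), "critical phenomena in gravitational collapse" (10: Gundlach–Baumgarte two-field  [refs: 2412.09540, 2601.04152, 2409.14582, 2605.16235, 2605.16095, 1604.00303, 2601.19515, 2210.11325, 2508.07655, 2207.04373, 2303.05530, 2606.27431, 2112.10826, 1912.08478, gr-qc/9503007, An2025, LiLiu2022, RodnianskiShlapentokhRothman2023, MerleEtAl2022]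

Barriers (technique_class: blow-up-analysis, self-similar-profiles, spectral): - technique_class: blow-up-analysis, self-similar-profiles, spectral
- Literature.Barriers.FinalStateConjecture.nakedSingularityInstability: evaded on both sides — (α)
no counterexample-to-generic-statement is drawn (the route PROVES positive codimension at naked
data, curve by curve, `IsTameChristodoulouGeneric … 1` shape, tame immersed curves on one fixed
end); (β) the argument is genericity-aware by construction (NakedDataTameExit quantifies over
exceptional data and produces the transversal tame family). Scope caveat (b) (regularity dependence,
Singh2024, now Zheng arXiv:2605.16235) is met head-on: instability is claimed only in the smooth
class for profiles tangent to smooth solutions; the BV blue-shift mechanism is not used.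
- Literature.Barriers.FinalStateConjecture.SlowlyRotatingKerrFrontier: it does not evade it; the bet
is confined to the imported item CensoredDataTameExit (large censored data must settle to Kerr with
|a| < M unrestricted), which every route of this summit shares; NakedDataTameExit's basin landing
inherits the same exposure for the exit data (now incl. honest radii, RaysStayInClosure,
IsFutureOriented of the final charts).
- Literature.Barriers.FinalStateConjecture.AretakisInstability: consistent — sub-extremality of the
final holes is demanded (ruling F4) and extremal endpoints enter CensoredDataTameExit as a fold-type
exceptional stratum to be exited, never as a target of C^k convergence up to the horizon.
- Literature.Barriers.FinalStateConjectur

History (route lifecycle, newest last):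
- 2026-08-16T23:18:08Z · rev 5: restated Assembly (stmt-FinalStateConjecture-9939) — route-repair (statement-revised, re-type T2 p126844): add tame cruxes NakedDataTameExit (r2) / CensoredDataTameExit (r3) whose conclusions are the re-typed good (planner-rrepair-FinalStateConjecture-TangentPr-439f4050-0)
- 2026-08-16T23:18:08Z · rev 5: dropped NakedDataExit, CensoredDataExit, LocalExitSuffices — route-repair (statement-revised, re-type T2 p126844): add tame cruxes NakedDataTameExit (r2) / CensoredDataTameExit (r3) whose conclusions are the re-typed good (planner-rrepair-FinalStateConjecture-TangentPr-439f4050-0)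
- 2026-08-24T06:17:22Z · DORMANT — reconciler: no traction for 6.6 d (last activity item-evidence-added at 2026-08-17T15:45:33Z); parked, not closed — `ledger route dormant route-FinalStateConjec (operator:999:3641157)
- 2026-08-30T17:13:22Z · REACTIVATED (open) — reconciler: reactivated — activity statement-checked at 2026-08-30T15:54:01Z after parking at 2026-08-24T06:17:22Z (operator:999:655229)
- 2026-09-04T18:31:52Z · DORMANT — reconciler: no traction for 5 d (last activity statement-checked at 2026-08-30T17:34:38Z); parked, not closed — `ledger route dormant route-FinalStateConjecture (operator:999:2103992)

sub-problem: FinalStateConjecture · status: dormant · opened planner-plancard-FinalStateConjecture-FinalSt-113d8173-0 2026-08-15T14:56:10Z · rev 6 · ledger route-FinalStateConjecture-TangentProfileCensorship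
GENERATED by the gate from the ledger (D-0016/17). Provers cite these decls: `theorem foo : Summit.FinalStateConjecture.FinalStateConjecture.Theses.TangentProfileCensorship.<Decl> := …` in Summits/FinalStateConjecture/FinalStateConjecture/Theorems/<Name>.lean.
-/

namespace Summit.FinalStateConjecture.FinalStateConjecture.Theses.TangentProfileCensorship

open scoped BigOperators Topology Manifold Classical MeasureTheory ProbabilityTheory Matrix InnerProductSpace ComplexConjugate ContinuousMap
open Filter Set Function TopologicalSpace MeasureTheory

attribute [summit_statement] _root_.FinalStateConjecture

/-! Retired items kept as plain definitions (history; not obligations of this route): landed proofs / closed glue still name them. -/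

-- tombstone: stmt-FinalStateConjecture-9938 was DROPPED from this route but is still named by active items / landed proofs — kept as a plain def (no route_item tag), not an obligation of this route
/-- retired stmt-FinalStateConjecture-9938 (dropped, gen None) — proved by Summit.FinalStateConjecture.FinalStateConjecture.Theorems.LocalExitSuffices_proof @ 442927d8e260. -/
def LocalExitSuffices : Prop :=
  ∀ (X : Type) [TopologicalSpace X] [ChartedSpace Literature.Geometry.Lorentzian.E3 X] [IsManifold (𝓡 3) ((⊤ : ℕ∞) : WithTop ℕ∞) X] [T2Space X] [SecondCountableTopology X] [ConnectedSpace X] (𝓔 : Set (Literature.Geometry.Lorentzian.InitialDataSet (𝓡 3) X)) (D : Literature.Geometry.Lorentzian.InitialDataSet (𝓡 3) X), (∃ F : EuclideanSpace ℝ (Fin 1) → Literature.Geometry.Lorentzian.InitialDataSet (𝓡 3) X, Literature.Geometry.Lorentzian.InitialDataSet.IsSmoothDataFamily 1 F ∧ F 0 = D ∧ Function.Injective F ∧ (∀ c, F c ∈ Literature.Geometry.Lorentzian.admissibleVacuumData X) ∧ ∃ ε : ℝ, 0 < ε ∧ ∀ c, c ≠ 0 → ‖c‖ < ε → F c ∉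 𝓔) → ∃ F : EuclideanSpace ℝ (Fin 1) → Literature.Geometry.Lorentzian.InitialDataSet (𝓡 3) X, Literature.Geometry.Lorentzian.InitialDataSet.IsSmoothDataFamily 1 F ∧ F 0 = D ∧ Function.Injective F ∧ (∀ c, F c ∈ Literature.Geometry.Lorentzian.admissibleVacuumData X) ∧ ∀ c, c ≠ 0 → F c ∉ 𝓔

/-- item stmt-FinalStateConjecture-17383 · crux · rank 2 · open · by planner
why it might fail: Zheng arXiv:2605.16235 Thm 1.3: CSS naked singularities are STABLE at threshold regularity, so only profiles tangent to SMOOTH data can be unstable; exit data must land in the FULL re-typed good set (Kerr settling, honest radii, rays in closure, orientation; known only for |a|≪M, arXiv:2104.11857).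
sources: Christodoulou1999instability, RodnianskiShlapentokhRothman2023, arXiv:2605.16235, arXiv:2605.16095, An2025, LiLiu2022
[crux] NAKED DATA TAME EXIT (card Steps 1–5 + basin landing, local form; re-typed T2, p126844): for
every connected Hausdorff second-countable smooth 3-manifold X and every admissible datum D on X
having a maximal vacuum Cauchy development with INCOMPLETE future null infinity (sojourn form),
there are ONE asymptotically flat end e of X and a one-parameter family F of admissible data, TAME
on e (`IsTameDataFamily e 1 F`: jointly smooth; e the sole end; every member Dafermos–Rodnianski
flat on e with continuous mass M(c); wDist-continuous at c = 0), IMMERSED at c = 0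
(`IsImmersedAtZero 1 F`), injective, with F 0 = D, and an ε > 0 such that for 0 < ‖c‖ < ε the datum
F c is GOOD in the re-typed sense: it has an MGHD, and every MGHD has complete 𝓘⁺ and carries a
sub-extremal N-Kerr final-state decomposition d of its self-determined exterior O = J⁺(ιX) ∩
I⁻(charts) such that every future-complete normalised null ray from the data stays in closure O
(`RaysStayInClosure`), the charts exhaust O with honest near-zone radii (`HasExhaustiveCharts`) and
chart time is future-oriented (`IsFutureOriented`). The exit direction is the transported unstable
smooth mode of the tangent profile realised -/
@[route_item "route-FinalStateConjecture-TangentProfileCensorship"]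
def NakedDataTameExit : Prop :=
  ∀ (X : Type) [TopologicalSpace X] [ChartedSpace Literature.Geometry.Lorentzian.E3 X] [IsManifold (𝓡 3) ((⊤ : ℕ∞) : WithTop ℕ∞) X] [T2Space X] [SecondCountableTopology X] [ConnectedSpace X], ∀ D ∈ Literature.Geometry.Lorentzian.admissibleVacuumData X, (∃ 𝒟 : Literature.Geometry.Lorentzian.VacuumCauchyDevelopment D, 𝒟.IsMaximal ∧ ¬ Summit.FinalStateConjecture.HasCompleteNullInfinity 𝒟.toCauchyDevelopment) → ∃ (e : Literature.Geometry.Lorentzian.AFEnd X) (F : EuclideanSpace ℝ (Fin 1) → Literature.Geometry.Lorentzian.InitialDataSet (𝓡 3) X), Literature.Geometry.Lorentzian.InitialDataSet.IsTameDataFamily e 1 F ∧ Literature.Geometry.Lorentzian.InitialDataSet.IsImmersedAtZero 1 F ∧ F 0 = D ∧ Function.Injective F ∧ (∀ c, F c ∈ Literature.Geometry.Lorentzian.admissibleVacuumData X) ∧ ∃ ε : ℝ, 0 < ε ∧ ∀ c, c ≠ 0 → ‖c‖ < ε → ((∃ 𝒟 : Literature.Geometry.Lorentzian.VacuumCauchyDevelopment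 (F c), 𝒟.IsMaximal) ∧ ∀ 𝒟 : Literature.Geometry.Lorentzian.VacuumCauchyDevelopment (F c), 𝒟.IsMaximal → Summit.FinalStateConjecture.HasCompleteNullInfinity 𝒟.toCauchyDevelopment ∧ ∃ (O : Set 𝒟.carrier) (d : Literature.Geometry.Lorentzian.FinalStateDecomposition 𝒟.toSpacetime O 2), (∀ i, Literature.Geometry.Lorentzian.Kerr.IsSubextremal (d.mass i) (d.spin i)) ∧ O = Summit.FinalStateConjecture.exteriorOf 𝒟.toCauchyDevelopment d.charted ∧ Summit.FinalStateConjecture.RaysStayInClosure 𝒟.toCauchyDevelopment O ∧ Summit.FinalStateConjecture.HasExhaustiveCharts d ∧ Summit.FinalStateConjecture.IsFutureOriented d)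

/-- item stmt-FinalStateConjecture-17348 · crux · rank 3 · open · by planner
why it might fail: Needs Kerr stability for LARGE censored data (only |a|≪M known, arXiv:2104.11857), non-genericity of extremal / infinitely-many-hole end states (arXiv:2211.15742); RaysStayInClosure is interior-flavoured: a future-complete null ray from Σ in the hole off closure(DOC) makes settled data exceptional.
sources: DafermosLuk2017, KlainermanSzeftel2023, GiorgiKlainermanSzeftel2022, DafermosHolzegelRodnianskiTaylor2021, KehleUnger2025, AngelopoulosKehleUnger2024
[crux] TAME CENSORED DATA EXIT (re-type T2 of the shared CensoredDataExit, Statement p126844,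
2026-08-16; the final-state half at censored data, local form; offered verbatim to
TangentProfileCensorship / HomotheticSurfaceGravity / NoVacuumStrings for re-attachment): for every
X as above and every admissible datum D which has an MGHD, all of whose MGHDs have complete 𝓘⁺, but
some MGHD of which carries no sub-extremal Kerr final-state decomposition d of its self-determined
exterior O = exteriorOf 𝒟 d.charted with RaysStayInClosure 𝒟 O, HasExhaustiveCharts d (honest radii)
and IsFutureOriented d, there are one asymptotically flat end e of X, an injective one-parameter
admissible family F through D (F 0 = D) tame on e and immersed at 0, and ε > 0 with F c good (as in
TameCurvatureModeExit) for 0 < ‖c‖ < ε. [difficulty: open-problem] -/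
@[route_item "route-FinalStateConjecture-TangentProfileCensorship"]
def CensoredDataTameExit : Prop :=
  ∀ (X : Type) [TopologicalSpace X] [ChartedSpace Literature.Geometry.Lorentzian.E3 X] [IsManifold (𝓡 3) ((⊤ : ℕ∞) : WithTop ℕ∞) X] [T2Space X] [SecondCountableTopology X] [ConnectedSpace X], ∀ D ∈ Literature.Geometry.Lorentzian.admissibleVacuumData X, (∃ 𝒟 : Literature.Geometry.Lorentzian.VacuumCauchyDevelopment D, 𝒟.IsMaximal) → (∀ 𝒟 : Literature.Geometry.Lorentzian.VacuumCauchyDevelopment D, 𝒟.IsMaximal → Summit.FinalStateConjecture.HasCompleteNullInfinity 𝒟.toCauchyDevelopment) → (∃ 𝒟 : Literature.Geometry.Lorentzian.VacuumCauchyDevelopment D, 𝒟.IsMaximal ∧ ¬ ∃ (O : Set 𝒟.carrier) (d : Literature.Geometry.Lorentzian.FinalStateDecomposition 𝒟.toSpacetime O 2), (∀ i, Literature.Geometry.Lorentzian.Kerr.IsSubextremal (d.mass i) (d.spin i)) ∧ O = Summit.FinalStateConjecture.exteriorOf 𝒟.toCauchyDevelopment d.charted ∧ Summit.FinalStateConjecture.RaysStayInClosure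 𝒟.toCauchyDevelopment O ∧ Summit.FinalStateConjecture.HasExhaustiveCharts d ∧ Summit.FinalStateConjecture.IsFutureOriented d) → ∃ (e : Literature.Geometry.Lorentzian.AFEnd X) (F : EuclideanSpace ℝ (Fin 1) → Literature.Geometry.Lorentzian.InitialDataSet (𝓡 3) X), Literature.Geometry.Lorentzian.InitialDataSet.IsTameDataFamily e 1 F ∧ Literature.Geometry.Lorentzian.InitialDataSet.IsImmersedAtZero 1 F ∧ F 0 = D ∧ Function.Injective F ∧ (∀ c, F c ∈ Literature.Geometry.Lorentzian.admissibleVacuumData X) ∧ ∃ ε : ℝ, 0 < ε ∧ ∀ c, c ≠ 0 → ‖c‖ < ε → ((∃ 𝒟 : Literature.Geometry.Lorentzian.VacuumCauchyDevelopment (F c), 𝒟.IsMaximal) ∧ ∀ 𝒟 : Literature.Geometry.Lorentzian.VacuumCauchyDevelopment (F c), 𝒟.IsMaximal → Summit.FinalStateConjecture.HasCompleteNullInfinity 𝒟.toCauchyDevelopment ∧ ∃ (O : Set 𝒟.carrier) (d : Literature.Geometry.Lorentzian.FinalStateDecomposition 𝒟.toSpacetime O 2), (∀ i, Literature.Geometry.Lorentzian.Kerr.IsSubextremal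 (d.mass i) (d.spin i)) ∧ O = Summit.FinalStateConjecture.exteriorOf 𝒟.toCauchyDevelopment d.charted ∧ Summit.FinalStateConjecture.RaysStayInClosure 𝒟.toCauchyDevelopment O ∧ Summit.FinalStateConjecture.HasExhaustiveCharts d ∧ Summit.FinalStateConjecture.IsFutureOriented d)

-- item stmt-FinalStateConjecture-9971 · support · rank 4 · open · by planner — informal only, no Lean statement yet:
--   [crux] TANGENT PROFILE EXTRACTION (card Steps 1-2; foreseen child of NakedDataExit in the glued
--   split TangentProfileExtraction -> SmoothProfileInstability -> NakedPointQuantisation ->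
--   NakedDataExit). For an MGHD of smooth admissible data with incomplete sojourn-scri+: (i) there is a
--   FIRST naked ideal point p (TIP on the future causal boundary, visible from the far region) whose
--   past cone meets J+(iota X) in a regular region; (ii) the scale-critical rescalings g_lambda =
--   lambda^-2 Phi_lambda^* g centred at p are precompact modulo gauge and every limit is a NONFLAT
--   continuously or discretely sel

-- item stmt-FinalStateConjecture-9972 · support · rank 5 · open · by planner — informal only, no Lean statement yet:
--   [crux] SMOOTH-CLASS PROFILE INSTABILITY + TWO-SIDED EXIT (card Steps 3-4; foreseen child of
--   NakedDataExit). Every nonflat CSS/DSS vacuum profile Z occurring as a tangent profile at a first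
--   naked point of an MGHD of SMOOTH admissible data has, modulo gauge and symmetry modes (scaling,
--   Poincare), at least one eigenvalue with Re > 0 of the linearised vacuum operator in self-similar
--   time s = -log(T-t) on SMOOTH weighted spaces (MRRS / Donninger technology, certified profile by
--   profile by interval arithmetic); and along the top unstable direction e, transported through the
--   constraint manifold to ad

-- item stmt-FinalStateConjecture-9974 · support · rank 6 · open · by planner — informal only, no Lean statement yet:
--   [crux] QUANTISATION + BASIN LANDING (card Step 5 and bookkeeping (6); foreseen child of
--   NakedDataExit; glue TangentProfileExtraction -> SmoothProfileInstability -> NakedPointQuantisation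
--   -> NakedDataExit). (i) Every tangent profile at a first naked point carries at least a quantum q0 >
--   0 of the scale-critical flux of TangentProfileExtraction, and the total flux available to first
--   naked points of one MGHD is bounded in terms of the admissible datum, so each admissible datum has
--   FINITELY many first naked points and one common exit direction (a generic combination of the
--   unstable directions) remo

/-- item stmt-FinalStateConjecture-9937 · support · rank 9 · open · by planner
sources: ChoquetBruhatGeroch1969CMP, Sbierski2016AHP, Ringstrom2009
[support] every admissible datum has a maximal globally hyperbolic vacuum development, stated over
the repaired structure `VacuumCauchyDevelopment` (the corrected form of the deprecated
`choquetBruhat_geroch_exists_mghd`, recorded in `CauchyProblemExistenceDefect`);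
Choquet-Bruhat–Geroch 1969 Thm. 3, Sbierski 2016 Thm. 2.6. Known theorem; large formalisation;
shared by every route of this summit. [difficulty: XL] -/
@[route_item "route-FinalStateConjecture-TangentProfileCensorship"]
def MGHDExistence : Prop :=
  ∀ (X : Type) [TopologicalSpace X] [ChartedSpace Literature.Geometry.Lorentzian.E3 X] [IsManifold (𝓡 3) ((⊤ : ℕ∞) : WithTop ℕ∞) X] [T2Space X] [SecondCountableTopology X] [ConnectedSpace X], ∀ D ∈ Literature.Geometry.Lorentzian.admissibleVacuumData X, ∃ 𝒟 : Literature.Geometry.Lorentzian.VacuumCauchyDevelopment D, 𝒟.IsMaximal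

-- earlier Assembly (stmt-FinalStateConjecture-9939, replaced 2026-08-16T23:18:08Z -> stmt-FinalStateConjecture-17382): retired by None — MGHDExistence → LocalExitSuffices → NakedDataExit → CensoredDataExit → FinalStateConjecture
/-- item stmt-FinalStateConjecture-17382 · assembly · rank 1 · open · by planner
sources: Christodoulou1999, DafermosLuk2017
[assembly] MGHDExistence → NakedDataTameExit → CensoredDataTameExit → FinalStateConjecture (re-typed
T2; literally the deciding theorem `closes`, whose local-to-global step is the proved Literature
lemma `isTameChristodoulouGeneric_of_local`). -/
@[route_item "route-FinalStateConjecture-TangentProfileCensorship"]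
def Assembly : Prop :=
  MGHDExistence → NakedDataTameExit → CensoredDataTameExit → FinalStateConjecture

-- records of items no longer active in this route (dropped / restated):
-- earlier LocalExitSuffices (stmt-FinalStateConjecture-9938, dropped 2026-08-16T23:18:08Z): proved by Summit.FinalStateConjecture.FinalStateConjecture.Theorems.LocalExitSuffices_proof @ 442927d8e260 — ∀ (X : Type) [TopologicalSpace X] [ChartedSpace Literature.Geometry.Lorentzian.E3 X] [IsManifold (𝓡 3) ((⊤ : ℕ∞) : WithTop ℕ∞) X] [T2Space X] [SecondCountableTopology X] [ConnectedSpace X] (𝓔 : Set (Li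

/-! D-0027 §2.1 — DECIDING THEOREM (planner-authored via `route open/edit --closes-file`; by planner-rrepair-FinalStateConjecture-TangentPr-439f4050-0 2026-08-16T23:18:08Z):
its hypotheses are this route's items and its conclusion the sub-problem Statement (glue_lint), and it elaborates with this file. -/

/-- The deciding theorem of route TangentProfileCensorship (D-0027 §2.1) after the statement re-type T2
(p126844, 2026-08-16: `IsTameChristodoulouGeneric` on one fixed end, honest near-zone radii, `RaysStayInClosure`,
`IsFutureOriented`): pure logic. `isTameChristodoulouGeneric_of_local` (Literature, TameGenericityLocal.lean, PROVED:
radial reparametrisation `c ↦ ε(1+‖c‖²)^{-1/2} c` preserves tameness, immersion at `0`, injectivity) reduces tame genericity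
to a LOCAL tame exit through every exceptional admissible datum `D`; case split on "every MGHD of `D` has complete `𝓘⁺`":
if not, `NakedDataTameExit` supplies the exit; if so, `MGHDExistence` gives an MGHD, exceptionality of `D` yields a maximal
development without a settling decomposition in the re-typed sense (sub-extremal, self-determined exterior, rays stay in the
closure, exhaustive honest charts, future-oriented), and `CensoredDataTameExit` supplies it. The new conjuncts
(`RaysStayInClosure`, honest-radii `HasExhaustiveCharts`, `IsFutureOriented`) and the tame/immersed witness family are supplied
by the two crux conclusions themselves (basin landing of the exit data), not by extra hypotheses. Conclusion
`_root_.FinalStateConjecture` by name; hypotheses exactly the three listed items. -/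
@[closes "route-FinalStateConjecture-TangentProfileCensorship"] theorem closes (hM : MGHDExistence) (hA : NakedDataTameExit) (hB : CensoredDataTameExit) :
    FinalStateConjecture := by
  intro X _ _ _ _ _ _
  refine Literature.Geometry.Lorentzian.InitialDataSet.isTameChristodoulouGeneric_of_local ?_
  intro D hAdm hbad
  by_cases hC : ∀ 𝒟 : Literature.Geometry.Lorentzian.VacuumCauchyDevelopment D, 𝒟.IsMaximal →
      Summit.FinalStateConjecture.HasCompleteNullInfinity 𝒟.toCauchyDevelopment
  · obtain ⟨𝒟₀, h𝒟₀⟩ := hM X D hAdm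
    have hns : ∃ 𝒟 : Literature.Geometry.Lorentzian.VacuumCauchyDevelopment D, 𝒟.IsMaximal ∧
        ¬ ∃ (O : Set 𝒟.carrier) (d : Literature.Geometry.Lorentzian.FinalStateDecomposition 𝒟.toSpacetime O 2),
          (∀ i, Literature.Geometry.Lorentzian.Kerr.IsSubextremal (d.mass i) (d.spin i)) ∧
            O = Summit.FinalStateConjecture.exteriorOf 𝒟.toCauchyDevelopment d.charted ∧
              Summit.FinalStateConjecture.RaysStayInClosure 𝒟.toCauchyDevelopment O ∧
                Summit.FinalStateConjecture.HasExhaustiveCharts d ∧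
                  Summit.FinalStateConjecture.IsFutureOriented d := by
      by_contra hcon
      refine hbad ⟨⟨𝒟₀, h𝒟₀⟩, fun 𝒟 h𝒟 ↦ ⟨hC 𝒟 h𝒟, ?_⟩⟩
      by_contra hset
      exact hcon ⟨𝒟, h𝒟, hset⟩
    obtain ⟨e, F, hF, himm, h0, hinj, hadm, ε, hε, hgood⟩ := hB X D hAdm ⟨𝒟₀, h𝒟₀⟩ hC hns
    exact ⟨e, F, hF, himm, h0, hinj, hadm, ε, hε, hgood⟩
  · have hC' : ∃ 𝒟 : Literature.Geometry.Lorentzian.VacuumCauchyDevelopment D, 𝒟.IsMaximal ∧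
        ¬ Summit.FinalStateConjecture.HasCompleteNullInfinity 𝒟.toCauchyDevelopment := by
      obtain ⟨𝒟, h𝒟⟩ := not_forall.mp hC
      exact ⟨𝒟, Classical.not_imp.mp h𝒟⟩
    obtain ⟨e, F, hF, himm, h0, hinj, hadm, ε, hε, hgood⟩ := hA X D hAdm hC'
    exact ⟨e, F, hF, himm, h0, hinj, hadm, ε, hε, hgood⟩

end Summit.FinalStateConjecture.FinalStateConjecture.Theses.TangentProfileCensorship
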